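import Summits.QuantumFields.BalabanUV.Beta.RowD1JointEnd
import Summits.QuantumFields.BalabanUV.Beta.AxialDressingRootedBmHessian
import Summits.QuantumFields.BalabanUV.Beta.RelInvBorderedHessian

/-!
# `BalabanUV.Beta.D1BFx.FirstStepPinned` — road «BF-x» (binder row D1), leaf O1 RE-BASED ON THE LITERAL OF RECORD:
# the one-shot jet data `JcPin` := the `j = 0` member of `RowD1JointEnd.JsRowD1Pin` at blocking `Lc^m`, the one-shot coefficient
# `shotCoeffPin … m μ ν := secondMoment (TshotOf Lc (JcPin …) m) μ ν`, and the road's root read BY NAME as the row's binder `D1Rep Lc (JcPin …)`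

HONEST FRAMING (cell contract, verbatim): «discharging `BetaPertH` makes Bałaban's UV stability UNCONDITIONAL — a real constructive-QFT
result; it is NOT the continuum limit and NOT the Clay problem.»  HONEST DEPENDENCY (verbatim): «continuum YM on T⁴ ⇐ BetaPertH ∧ nine
spine estimates (0/9 proved); BetaPertH ⇐ (D1) ∧ (D4) ∧ CAP+tail; G-an2-4 gates asym, D1 and NE2/3/4.»  THIS MODULE DISCHARGES NOTHING:
two DEFINITIONS over objects already in the tree (the row-D1 literal of record `RowD1JointEnd.JsRowD1Pin`, an4/an2's
`OneStepKernelFamily.TshotOf` / `TbalOf` / `D1Rep`, `B12Beta.secondMoment`) and their unfolding lemmas; no `Prop` is minted, nothing is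
cited as a hypothesis, no binder of the wall (hW, hR, D1Tel, D1Rep) is instantiated.  0 sorry.  NOT summit progress.

ABSOLUTE RULE (cell, verbatim): «No internally-minted statement may enter as a cited fact. Every hypothesis is either kernel-proved in this
package or a verbatim quotation of a PUBLISHED theorem with page reference. The manuscript(s) under audit are NOT citable for their own
disputed steps — they are the thing under adjudication; programme-internal (2001/route/tribunal) claims are never citable.»

WHY (road «BF-x» owner, gen 4; FINDING «O1-LITERAL», located).  Leaf O1 `D1BFx.FirstStepLargeBlock.shotCoeff` (this road, gen 1) reads
the one-shot coefficient off `MixedJetTablesPlug.JsBalAn1Ctr`, i.e. off the ROOT-normalised axial dressing `AxialDressing.axDressK` /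
`axVertexOfK` (projector `AxialProjector.axProj = 1 − grad∘treeGauge`, gauge functions vanishing at the block base points).  Since the
β-lead's ruling on NOTE X-an2-42 (kernel anchor `AxialProjectorBlockMean.contourSum_axProjAt` / `contourSum_axProjBmAt`: only the
BLOCK-MEAN-normalised projector is blind to the typed straight averaging `contourSum`, so only `Π_bm` may dress the typed resolvent), the
row's literal of record is the `Π_bm`-dressed recursive family — `RowD1JointEnd.JsRowD1Pin hLc N` (= `SpineRooted.JsRecWAtOf` at an1's tables,
centred root, odd `Lc`, pinned colour constants `(cE, cVH, cΛ, cE₂, cB) = (Lc⁴, −Lc⁸∕2, 2∕Lc⁴, Lc⁸, −Lc¹²∕4)`, Wilson table `(8N²)⁻¹ • wsym22 N`).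
This file RE-BASES O1 on it, with no exponent socket left (the pin fixes the block-size powers), and makes the road's target LITERALLY the
row's proof-route binder: `D1Rep Lc (JcPin hLc N) Nc μ ν a SL k` (`OneStepKernelFamily.D1Rep`, consumed by
`RowD1JointEnd.d1Drift_JsRowD1Pin_of_letters_D1Tel_D1Rep`).  The road's ENDs (`RoadEndBFxTotal.d1Drift_BFx_total` &c.) are literal-agnostic
(`Js`, `c` free) and are not touched.

CONTENT (all [folklore] / [our object]).
* §1 `JcPin hLc N : ∀ m, JetData 3 (Lc ^ m)` := `fun m ↦ JsRowD1Pin (Lc := Lc ^ m) _ N 0` — THE ONE-SHOT JET DATA AT BLOCKING `Lc^m` read as the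
  `j = 0` member of the literal of record taken at block size `Lc := Lc^m` (the one-shot system with blocking `n` IS the first step at block `n`).
* §2 `shotCoeffPin hLc N m μ ν := secondMoment (TshotOf Lc (JcPin hLc N) m) μ ν`; `d1Rep_JcPin_iff` (the road's root ↔ the row's binder, `Iff.rfl`).
* §3 `TshotOf_JcPin_eq_TbalOf_zero` : `TshotOf Lc (JcPin hLc N) m = TbalOf (Lc^m) (JsRowD1Pin _ N) 0` (`RelInvBorderedHessian.KInvStep_zero_eq`,
  `OneStepKernelFamily.vertexOfK_KInv`), and the CO-DRESSED DISPLAY `TshotOf_JcPin_codressed`: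
  `= hessKer G (vertexOfK G n S₀) W₀`, `G := coDressKBmAt ρ_c n (KInv n)` (`Π_bmᵀ·KInv·Π_bm`), `S₀ := SrecAt 3 n ρ_c n⁴ (−n⁸∕2) (2∕n⁴) 0`,
  `W₀ := WrecAt 3 n ρ_c … 0`, `n := Lc^m`, `ρ_c := toSite (ctrOff 4 n)` (`AxialDressingRooted.TbalOf_dressBmAt` BY NAME) — the left-hand side of
  the road's slot (K) from v1.10 on.
-/

open Finset
open scoped BigOperators
open Literature.MathematicalPhysics.QuantumFieldTheory
open Literature.MathematicalPhysics.QuantumFieldTheory.Balaban1983to89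
open Literature.MathematicalPhysics.QuantumFieldTheory.Balaban1983to89.Beta
open ExpKernelCalculus (hessKer)
open AffineAveraging (box toSite)
open AveragingContoursRooted (ctrOff ctrOff_mem_box)
open AveragingMixedJetTables (mixFFAt)
open OneStepResolventKernel (Fib JetData TOf KInv vertexOf)
open OneStepKernelFamily (TbalOf TshotOf TstepOf KInvStep vertexOfK D1Rep vertexOfK_KInv)
open ScalewiseVectorSeam (oneShotSide)
open WilsonVertex2Sym (wsym22)
open Summit.QuantumFields.BalabanUV.Beta.RowD1JointEnd (JsRowD1 JsRowD1Pin JsRowD1Pin_eq JsRowD1_eq)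
open Summit.QuantumFields.BalabanUV.Beta.SpineRooted (JsRecWAtOf JsRecWAtOf_eq JsRecBmAtOf JsRec0AtOf JsRec0AtOf_S JsRec0AtOf_W WrecAt)
open Summit.QuantumFields.BalabanUV.Beta.WardLocusRecursive (SrecAt)
open Summit.QuantumFields.BalabanUV.Beta.SecondOrderSocketIdentification (vh₂SAn1)
open Summit.QuantumFields.BalabanUV.Beta.AxialDressingRooted (coDressKBmAt dressBmAt TbalOf_dressBmAt)
open Summit.QuantumFields.BalabanUV.Beta.BorderedHessian (KInvStep_zero_eq)

namespace Summit.QuantumFields.BalabanUV.Beta.D1BFx.FirstStepPinned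

noncomputable section

variable {Lc : ℕ} [NeZero Lc]

/-! ## §1 The one-shot jet data at blocking `Lc^m` -/

/-- [our object] **THE ONE-SHOT JET DATA AT BLOCKING `Lc^m`** := the `j = 0` member of the row-D1 literal of record `JsRowD1Pin` taken at block
size `Lc := Lc^m` (odd, since `Lc` is odd).  A NAME for an existing literal; nothing asserted. -/
def JcPin (hLc : Odd Lc) (N : ℕ) : ∀ m : ℕ, JetData 3 (Lc ^ m) :=
  fun m => JsRowD1Pin (Lc := Lc ^ m) (hLc.pow) N 0

/-- [folklore] `JcPin` unfolds (`rfl`). -/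
theorem JcPin_apply (hLc : Odd Lc) (N m : ℕ) : JcPin hLc N m = JsRowD1Pin (Lc := Lc ^ m) (hLc.pow) N 0 := rfl

/-! ## §2 The one-shot coefficient and the road's root as the row's binder -/

/-- [our object] **THE ONE-SHOT (1.22)-COEFFICIENT OF RECORD** at blocking `Lc^m`, channel `(μ, ν)`: the second moment of the one-shot kernel
`TshotOf Lc (JcPin hLc N) m`.  A DEFINITION; asserts nothing. -/
def shotCoeffPin (hLc : Odd Lc) (N : ℕ) (m : ℕ) (μ ν : Fin 4) : ℝ :=
  B12Beta.secondMoment (TshotOf Lc (JcPin hLc N) m) μ ν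

/-- [folklore] Unfolding of `shotCoeffPin` (`rfl`). -/
theorem shotCoeffPin_eq (hLc : Odd Lc) (N m : ℕ) (μ ν : Fin 4) :
    shotCoeffPin hLc N m μ ν = B12Beta.secondMoment (TshotOf Lc (JcPin hLc N) m) μ ν := rfl

/-- [folklore] **THE ROAD's ROOT IS THE ROW's BINDER `D1Rep` AT `Jc := JcPin hLc N`** (definitional): `D1Rep Lc (JcPin hLc N) Nc μ ν a SL k` says
`∃ U, ∀ m ≥ 1, |shotCoeffPin hLc N m μ ν − oneShotSide SL μ ν Nc a k (Lc^m)| ≤ U`. -/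
theorem d1Rep_JcPin_iff {L : Type*} (hLc : Odd Lc) (N : ℕ) (Nc : ℝ) (μ ν : Fin 4) (a : ℝ) (SL : Finset L) (k : L → Fin 4) :
    D1Rep Lc (JcPin hLc N) Nc μ ν a SL k ↔
      ∃ U : ℝ, ∀ m : ℕ, 1 ≤ m → |shotCoeffPin hLc N m μ ν - oneShotSide SL μ ν Nc a k (Lc ^ m)| ≤ U :=
  Iff.rfl

/-- [folklore] The binder from a uniform bound (the direction the road supplies). -/
theorem d1Rep_JcPin_of_bound {L : Type*} (hLc : Odd Lc) (N : ℕ) {Nc : ℝ} {μ ν : Fin 4} {a : ℝ} {SL : Finset L} {k : L → Fin 4}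
    {U : ℝ} (h : ∀ m : ℕ, 1 ≤ m → |shotCoeffPin hLc N m μ ν - oneShotSide SL μ ν Nc a k (Lc ^ m)| ≤ U) :
    D1Rep Lc (JcPin hLc N) Nc μ ν a SL k :=
  ⟨U, h⟩

/-! ## §3 The one-shot kernel is the first step at block `Lc^m`; co-dressed display -/

/-- [folklore] For ANY step data at blocking `n`, the one-shot kernel `TOf` IS the `j = 0` step kernel `TbalOf n Js 0`
(`KInvStep n 0 = KInv n`, chain-rule vertex through the `ℋ`-column of `KInv n`). -/
theorem TOf_eq_TbalOf_zero {n : ℕ} [NeZero n] (Js : ℕ → JetData 3 n) : TOf (N := n) (Js 0) = TbalOf n Js 0 := by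
  show _ = TstepOf n 0 (Js 0)
  unfold TstepOf TOf
  have hV : vertexOfK (KInv (N := n) (d := 3)) n (Js 0).S = vertexOf (N := n) (Js 0).S :=
    funext fun μ => funext fun y => vertexOfK_KInv _ μ y
  rw [KInvStep_zero_eq, hV]

/-- [folklore] **THE ONE-SHOT KERNEL AT BLOCKING `Lc^m` IS THE FIRST STEP OF THE LITERAL OF RECORD AT BLOCK `Lc^m`.** -/
theorem TshotOf_JcPin_eq_TbalOf_zero (hLc : Odd Lc) (N m : ℕ) :
    TshotOf Lc (JcPin hLc N) m = TbalOf (Lc ^ m) (JsRowD1Pin (Lc := Lc ^ m) (hLc.pow) N) 0 :=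
  TOf_eq_TbalOf_zero (n := Lc ^ m) (JsRowD1Pin (Lc := Lc ^ m) (hLc.pow) N)

/-- [folklore] `shotCoeffPin` as the `(1.22)`-moment of the first step at block `Lc^m`. -/
theorem shotCoeffPin_eq_secondMoment_TbalOf_zero (hLc : Odd Lc) (N m : ℕ) (μ ν : Fin 4) :
    shotCoeffPin hLc N m μ ν = B12Beta.secondMoment (TbalOf (Lc ^ m) (JsRowD1Pin (Lc := Lc ^ m) (hLc.pow) N) 0) μ ν := by
  rw [shotCoeffPin_eq, TshotOf_JcPin_eq_TbalOf_zero]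

/-- [folklore] **THE FIRST STEP OF THE LITERAL OF RECORD IN CO-DRESSED FORM** (any odd block size `n`, `j = 0`): resolvent
`G := coDressKBmAt ρ_c n (KInv n)` (`Π_bmᵀ·KInv n·Π_bm`, centred root `ρ_c := toSite (ctrOff 4 n)`), chain-rule vertex through the `ℋ`-column of `G`
over the UNDRESSED first-order stencils `SrecAt 3 n ρ_c n⁴ (−n⁸∕2) (2∕n⁴) 0` (= `S0NAt`: Wilson cubic + averaging border + Λ), undressed second-order
vertex `WrecAt 3 n ρ_c … 0` (`AxialDressingRooted.TbalOf_dressBmAt` BY NAME + `KInvStep n 0 = KInv n`). -/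
theorem TbalOf_JsRowD1Pin_zero_codressed {n : ℕ} [NeZero n] (hn : Odd n) (N : ℕ) :
    TbalOf n (JsRowD1Pin hn N) 0 =
      hessKer (coDressKBmAt (toSite (ctrOff 4 n)) n (KInv (N := n) (d := 3)))
        (vertexOfK (coDressKBmAt (toSite (ctrOff 4 n)) n (KInv (N := n) (d := 3))) n
          (SrecAt 3 n (toSite (ctrOff 4 n)) ((n : ℝ) ^ 4) (-((n : ℝ) ^ 8 / 2)) (2 / (n : ℝ) ^ 4) 0))
        (WrecAt 3 n (toSite (ctrOff 4 n)) ((n : ℝ) ^ 4) (-((n : ℝ) ^ 8 / 2)) (2 / (n : ℝ) ^ 4) ((n : ℝ) ^ 8) (-((n : ℝ) ^ 12 / 4))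
          ((8 * (N : ℝ) ^ 2)⁻¹ • wsym22 N) (vh₂SAn1 n) (mixFFAt (toSite (ctrOff 4 n)) n) 0) := by
  rw [JsRowD1Pin_eq, JsRowD1_eq, JsRecWAtOf_eq]
  unfold SpineRooted.JsRecBmAtOf
  rw [TbalOf_dressBmAt, KInvStep_zero_eq, JsRec0AtOf_S, JsRec0AtOf_W]

/-- [folklore] **THE ONE-SHOT KERNEL OF RECORD IN CO-DRESSED FORM** at blocking `n := Lc^m` — the left-hand side of the road's slot (K). -/
theorem TshotOf_JcPin_codressed (hLc : Odd Lc) (N m : ℕ) :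
    TshotOf Lc (JcPin hLc N) m =
      hessKer (coDressKBmAt (toSite (ctrOff 4 (Lc ^ m))) (Lc ^ m) (KInv (N := Lc ^ m) (d := 3)))
        (vertexOfK (coDressKBmAt (toSite (ctrOff 4 (Lc ^ m))) (Lc ^ m) (KInv (N := Lc ^ m) (d := 3))) (Lc ^ m)
          (SrecAt 3 (Lc ^ m) (toSite (ctrOff 4 (Lc ^ m))) (((Lc ^ m : ℕ) : ℝ) ^ 4) (-(((Lc ^ m : ℕ) : ℝ) ^ 8 / 2))
            (2 / ((Lc ^ m : ℕ) : ℝ) ^ 4) 0))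
        (WrecAt 3 (Lc ^ m) (toSite (ctrOff 4 (Lc ^ m))) (((Lc ^ m : ℕ) : ℝ) ^ 4) (-(((Lc ^ m : ℕ) : ℝ) ^ 8 / 2))
          (2 / ((Lc ^ m : ℕ) : ℝ) ^ 4) (((Lc ^ m : ℕ) : ℝ) ^ 8) (-(((Lc ^ m : ℕ) : ℝ) ^ 12 / 4))
          ((8 * (N : ℝ) ^ 2)⁻¹ • wsym22 N) (vh₂SAn1 (Lc ^ m)) (mixFFAt (toSite (ctrOff 4 (Lc ^ m))) (Lc ^ m)) 0) := by
  rw [TshotOf_JcPin_eq_TbalOf_zero]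
  exact TbalOf_JsRowD1Pin_zero_codressed (n := Lc ^ m) hLc.pow N

end

end Summit.QuantumFields.BalabanUV.Beta.D1BFx.FirstStepPinned
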